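import Summits.QuantumFields.YangMills.Theorems.AllWindowsColdBoxBoxHighLineGaussianNormalFormOnD
import Summits.QuantumFields.YangMills.Theorems.AllWindowsColdBoxBoxHighLineBoxToChartReductionCore
import Summits.QuantumFields.YangMills.Theorems.AllWindowsColdBoxBoxHighLinePlaqCostSizesOnD

/-!
# U5 Steps D–E glue at `t = 1` ON THE CUT SET — 13D′ (Gaussian normal form on a measurable `D′ ⊆ smallField H s`) and C′ (restricting the
# FP-chart covariance from `D` to `D′` costs `6·τ·B²`, `τ` = the FP-weight mass ratio of `D ∖ D′`)
# (planner ym-idea-2 g18, `Cruxes/BoxWindowHighSU2213/ASSEMBLY-U5.md` v0.2 §3 (D′); LINE-20 U5 ⟨stmt-QuantumFields-24336⟩; U5 prep, helper-grade; U5 OPEN)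

Width seat `ym-line-sfw-p2-w2` (g33).  The ε₁-half of the third-order assembly ends in the chart covariance over the small field
`D = smallField H s` with the FP-chart weight `w_J = fpChartWeight β H r` (✓`BoxToChart.boxPlaqCov_sub_chartCov_relative_sup'`, w2 g32), while the
third-order tilt expansion (✓13u³ `…TiltThirdOrderMuD`, κ₃/κ₄ exact by Wick, κ₅ by Hölder) runs on the restricted Gaussian `μ_{D′}` of the CUT small field
`D′ = D ∖ E`, `E` = the cubic-cut event of ✓`SmallFieldFP.cubicCutInsideFP` / ✓`SmallFieldFP.exists_beta0_cubicCut` (w4 g29), where `sup_{D′}|tiltU| ≤ 2`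
(✓`TiltSup.exists_forall_abs_tiltU_le_on_cubicCut`).  This file is the glue between the two currencies, for an ARBITRARY measurable `D′ ⊆ D`:

* §1 (ns `…Restrict`, abstract): ★`abs_covDensity_sub_covDensity_subset_le` — for a measure `μ`, a measurable weight `w ≥ 0` integrable on `D` with
  `0 < ∫_D w`, measurable `D′ ⊆ D` with `∫_{D∖D′} w ≤ τ·∫_D w`, `τ ≤ 1/2`, and measurable `|F|, |G| ≤ B`:
  `|Cov^w_D(F,G) − Cov^w_{D′}(F,G)| ≤ 6τB²`, where `Cov^w_S(F,G) = (∫_S FG w)/(∫_S w) − (∫_S F w)/(∫_S w)·(∫_S G w)/(∫_S w)` (quotient letters) —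
  ✓13r `Restrict.abs_cov_sub_cov_restrict_le` applied to `ν := (μ.restrict D).withDensity (ofReal ∘ w)`;
* §2 (ns `…GaussNormalForm`) 13D′: `setIntegral_mul_fpChartWeight_eq_of_subset` (`∫_{D′} G·w_J = K·∫_{D′} G·e^{tiltU}·gaussWeight`, ✓5n-R pointwise on `D ⊇ D′`),
  ★`setIntegral_fpChartWeight_div_eq_of_subset` / ★`cov_fpChartWeight_eq_of_subset` (`Cov^{w_J}_{D′}(F,G) = Tilt.tiltCov μ_{D′} (tiltU β H) 1 F G` with
  `μ_{D′} := (volume.restrict D′).withDensity (ofReal ∘ gaussWeight β H)` — ✓13D verbatim with `D′` for `D`), `tiltExp_fpChart_eq_of_subset`, `tiltCov_fpChart_eq_of_subset`;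
* §3 (ns `…GaussNormalForm`) C′: `fpChartWeight_pos_of_mem_smallField`, `integrableOn_mul_fpChartWeight_smallField`, `setIntegral_fpChartWeight_smallField_pos`,
  ★★`abs_chartCov_sub_chartCov_subset_le` (`|Cov^{w_J}_D(F,G) − Cov^{w_J}_{D′}(F,G)| ≤ 6τB²` under `∫_{D∖D′} w_J ≤ τ·∫_D w_J`), the cut-event form
  ★★`abs_chartCov_sub_chartCov_diff_le` (`D′ = D ∖ E`, hypothesis `∫_{D∩E} w_J ≤ τ·∫_{D∖E} w_J` — EXACTLY the conclusion shape of ✓`exists_beta0_cubicCut`, `τ = β^{−q}`),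
  and the composites ★★`abs_chartCov_sub_tiltCov_muCut_one_le` (`|Cov^{w_J}_D(F,G) − Tilt.tiltCov μ_{D∖E} (tiltU β H) 1 F G| ≤ 6τB²`) and
  `abs_chartCov_sub_tiltCov_muCut_one_le_chartPlaqCost` (`B = 4` by ✓`TiltSup.abs_chartPlaqCost_le_four`: `≤ 96τ`).

Mathlib + tree only (✓GaussianNormalFormOnD, ✓BoxToChartReductionCore for `integrableOn_obs_mul_fpChartWeight`, ✓PlaqCostSizesOnD); no definitions; standard axioms.
HONEST LABEL: plumbing for the (UNSTAFFED) third-order assembly `landauThirdOrder_of` of the XL stub U5 of a critic-PASSed DRAFT line; U5, ⟨24336⟩, ⟨24004⟩ and the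
seat's own crux ⟨22884⟩ remain OPEN; route AllWindowsColdBox is DRAFT; no crux, rung or summit is proved; **the Yang–Mills mass gap is NOT proved by this file;
no summit is proved by a line.**
-/

set_option autoImplicit false

noncomputable section

open MeasureTheory Set
open Literature.MathematicalPhysics.QuantumFieldTheory.Balaban1983to89.B10Eq22Rescaling (sigmaSU2 sigmaSU2_pos)
open Literature.Probability.LatticeModels (Site)

namespace Summit.QuantumFields.YangMills.Theorems.AllWindowsColdBoxBoxHighLine

/-! ## §1 Abstract: restricting a density-weighted covariance from `D` to `D′ ⊆ D` -/

namespace Restrict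

variable {Ω : Type*} [MeasurableSpace Ω] {μ : Measure Ω}

/-- ★ **Density-weighted covariances move by `≤ 6τB²` under restriction to a subset.**  `w ≥ 0` measurable and integrable on `D` with `0 < ∫_D w`,
`D′ ⊆ D` measurable with `∫_{D∖D′} w ≤ τ·∫_D w`, `τ ≤ 1/2`, `F`, `G` measurable with `|F|, |G| ≤ B`: the quotient-letter covariances
`Cov^w_S(F,G) = (∫_S FGw)/(∫_S w) − (∫_S Fw)/(∫_S w)·((∫_S Gw)/(∫_S w))` for `S = D` and `S = D′` differ by at most `6τB²`
(✓`Restrict.abs_cov_sub_cov_restrict_le` for the finite measure `(μ.restrict D).withDensity (ofReal ∘ w)`). -/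
theorem abs_covDensity_sub_covDensity_subset_le {w : Ω → ℝ} (hw : Measurable w) (hw0 : ∀ x, 0 ≤ w x) {D D' : Set Ω}
    (hD' : MeasurableSet D') (hsub : D' ⊆ D) (hwi : IntegrableOn w D μ) (hpos : 0 < ∫ x in D, w x ∂μ) {τ : ℝ}
    (hτ : ∫ x in D \ D', w x ∂μ ≤ τ * ∫ x in D, w x ∂μ) (hτ2 : τ ≤ 1 / 2) {F G : Ω → ℝ} {B : ℝ} (hFm : Measurable F) (hGm : Measurable G)
    (hFb : ∀ x, |F x| ≤ B) (hGb : ∀ x, |G x| ≤ B) :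
    |((∫ x in D, F x * G x * w x ∂μ) / (∫ x in D, w x ∂μ) -
          (∫ x in D, F x * w x ∂μ) / (∫ x in D, w x ∂μ) * ((∫ x in D, G x * w x ∂μ) / (∫ x in D, w x ∂μ))) -
        ((∫ x in D', F x * G x * w x ∂μ) / (∫ x in D', w x ∂μ) -
          (∫ x in D', F x * w x ∂μ) / (∫ x in D', w x ∂μ) * ((∫ x in D', G x * w x ∂μ) / (∫ x in D', w x ∂μ)))| ≤
      6 * τ * B ^ 2 := by
  set ν : Measure Ω := (μ.restrict D).withDensity fun x => ENNReal.ofReal (w x) with hν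
  haveI : IsFiniteMeasure ν := isFiniteMeasure_withDensity_ofReal hwi.hasFiniteIntegral
  -- every `ν`-integral is a `w`-weighted integral over `D`
  have hint : ∀ h : Ω → ℝ, ∫ x, h x ∂ν = ∫ x in D, h x * w x ∂μ := fun h => Tilt.integral_withDensity_ofReal_eq _ hw hw0 h
  have hU : ν.real univ = ∫ x in D, w x ∂μ := by
    have h1 := hint fun _ => (1 : ℝ)
    simp only [integral_const, smul_eq_mul, mul_one, one_mul] at h1
    exact h1
  haveI : NeZero ν := by
    refine ⟨fun h0 => ?_⟩
    have : ν.real univ = 0 := by rw [h0]; rfl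
    linarith
  -- the restriction of `ν` to `D′` is the density measure over `D′`
  have hνr : ν.restrict D' = (μ.restrict D').withDensity fun x => ENNReal.ofReal (w x) := by
    rw [hν, restrict_withDensity hD', Measure.restrict_restrict hD', inter_eq_left.2 hsub]
  have hint' : ∀ h : Ω → ℝ, ∫ x in D', h x ∂ν = ∫ x in D', h x * w x ∂μ := fun h => by
    rw [hνr]; exact Tilt.integral_withDensity_ofReal_eq _ hw hw0 h
  have hD'r : ν.real D' = ∫ x in D', w x ∂μ := by
    have h1 := hint' fun _ => (1 : ℝ)
    rw [← measureReal_restrict_apply_univ]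
    simp only [integral_const, smul_eq_mul, mul_one, one_mul] at h1
    exact h1
  have hcr : ν.real D'ᶜ = ∫ x in D \ D', w x ∂μ := by
    have h1 := measureReal_add_measureReal_compl (μ := ν) hD'
    rw [setIntegral_sdiff hD' hwi hsub, ← hU, ← hD'r]
    linarith
  have hτ' : ν.real D'ᶜ ≤ τ * ν.real univ := by rw [hcr, hU]; exact hτ
  have h := Restrict.abs_cov_sub_cov_restrict_le (μ := ν) hD' hτ' hτ2 hFm.aestronglyMeasurable hGm.aestronglyMeasurable hFb hGb
  rw [hint, hint, hint, hint', hint', hint', hU, hD'r] at h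
  exact h

end Restrict

/-! ## §2 13D′: the Gaussian normal form on a measurable subset of the small field -/

namespace GaussNormalForm

open EdgeChartGaussian (gaussWeight_pos)

variable {H : ℕ} {β r s : ℝ}

/-- ★ On a measurable `D′ ⊆ smallField H s` the FP-chart weight integrates like `K` times the `t = 1` tilted Gaussian:
`∫_{D′} G·w_J = K · ∫_{D′} G·e^{tiltU}·gaussWeight` for every `G` (✓5n-R `fpChartWeight_eq_on_smallField` pointwise on `D ⊇ D′`). -/
theorem setIntegral_mul_fpChartWeight_eq_of_subset (hH : 1 ≤ H) (hs0 : 0 ≤ s) (hsr : s ≤ r) (hsπ : s < Real.pi) (hr : 0 < r)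
    (hdet : ∀ a ∈ smallField H s, (fpOperator H (edgeChart H a)).det ≠ 0) {D' : Set (LandauFree H → E3)} (hD'm : MeasurableSet D')
    (hD' : D' ⊆ smallField H s) (G : (LandauFree H → E3) → ℝ) :
    ∫ a in D', G a * fpChartWeight β H r a =
      (|(fpOperator H 1).det| * sigmaSU2 0 ^ Fintype.card (LandauFree H)) *
        ∫ a in D', G a * Real.exp (tiltU β H a) * gaussWeight β H a := by
  rw [← integral_const_mul]
  refine setIntegral_congr_fun hD'm fun a ha => ?_
  rw [fpChartWeight_eq_on_smallField hH hs0 hsr hsπ hr (hD' ha) (hdet a (hD' ha))]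
  ring

/-- ★★ **13D′**: every normalised FP-chart average on `D′` is the `t = 1` tilted Gaussian average over `μ_{D′}` —
`Tilt.tiltExp ν_{J,D′} U′ 0 G = Tilt.tiltExp μ_{D′} (tiltU β H) 1 G` (every `G`, every dummy `U′`). -/
theorem tiltExp_fpChart_eq_of_subset (hH : 1 ≤ H) (hs0 : 0 ≤ s) (hsr : s ≤ r) (hsπ : s < Real.pi) (hr : 0 < r)
    (hdet : ∀ a ∈ smallField H s, (fpOperator H (edgeChart H a)).det ≠ 0) {D' : Set (LandauFree H → E3)} (hD'm : MeasurableSet D')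
    (hD' : D' ⊆ smallField H s) (U' G : (LandauFree H → E3) → ℝ) :
    Tilt.tiltExp (((volume : Measure (LandauFree H → E3)).restrict D').withDensity fun a => ENNReal.ofReal (fpChartWeight β H r a)) U' 0 G =
      Tilt.tiltExp (((volume : Measure (LandauFree H → E3)).restrict D').withDensity fun a => ENNReal.ofReal (gaussWeight β H a))
        (tiltU β H) 1 G := by
  rw [Tilt.tiltExp_withDensity_ofReal_zero _ (FPChart.measurable_fpChartWeight β H r) (FPChart.fpChartWeight_nonneg β r),
    Tilt.tiltExp_withDensity_ofReal _ (measurable_gaussWeight β H) (fun a => (gaussWeight_pos β H a).le)]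
  simp only [one_mul]
  rw [setIntegral_mul_fpChartWeight_eq_of_subset hH hs0 hsr hsπ hr hdet hD'm hD' G]
  have h1 := setIntegral_mul_fpChartWeight_eq_of_subset (β := β) hH hs0 hsr hsπ hr hdet hD'm hD' (fun _ => (1 : ℝ))
  simp only [one_mul] at h1
  rw [h1, mul_div_mul_left _ _ (const_ne_zero H)]

/-- ★ The same for covariances: `Tilt.tiltCov ν_{J,D′} U′ 0 F G = Tilt.tiltCov μ_{D′} (tiltU β H) 1 F G`. -/
theorem tiltCov_fpChart_eq_of_subset (hH : 1 ≤ H) (hs0 : 0 ≤ s) (hsr : s ≤ r) (hsπ : s < Real.pi) (hr : 0 < r)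
    (hdet : ∀ a ∈ smallField H s, (fpOperator H (edgeChart H a)).det ≠ 0) {D' : Set (LandauFree H → E3)} (hD'm : MeasurableSet D')
    (hD' : D' ⊆ smallField H s) (U' F G : (LandauFree H → E3) → ℝ) :
    Tilt.tiltCov (((volume : Measure (LandauFree H → E3)).restrict D').withDensity fun a => ENNReal.ofReal (fpChartWeight β H r a)) U' 0 F G =
      Tilt.tiltCov (((volume : Measure (LandauFree H → E3)).restrict D').withDensity fun a => ENNReal.ofReal (gaussWeight β H a))
        (tiltU β H) 1 F G := by
  simp only [Tilt.tiltCov, tiltExp_fpChart_eq_of_subset hH hs0 hsr hsπ hr hdet hD'm hD']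

/-- ★ Quotient currency on `D′`: `(∫_{D′} G·w_J)/(∫_{D′} w_J) = Tilt.tiltExp μ_{D′} (tiltU β H) 1 G`. -/
theorem setIntegral_fpChartWeight_div_eq_of_subset (hH : 1 ≤ H) (hs0 : 0 ≤ s) (hsr : s ≤ r) (hsπ : s < Real.pi) (hr : 0 < r)
    (hdet : ∀ a ∈ smallField H s, (fpOperator H (edgeChart H a)).det ≠ 0) {D' : Set (LandauFree H → E3)} (hD'm : MeasurableSet D')
    (hD' : D' ⊆ smallField H s) (G : (LandauFree H → E3) → ℝ) :
    (∫ a in D', G a * fpChartWeight β H r a) / (∫ a in D', fpChartWeight β H r a) =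
      Tilt.tiltExp (((volume : Measure (LandauFree H → E3)).restrict D').withDensity fun a => ENNReal.ofReal (gaussWeight β H a))
        (tiltU β H) 1 G := by
  rw [← tiltExp_fpChart_eq_of_subset hH hs0 hsr hsπ hr hdet hD'm hD' (fun _ => 0) G,
    Tilt.tiltExp_withDensity_ofReal_zero _ (FPChart.measurable_fpChartWeight β H r) (FPChart.fpChartWeight_nonneg β r)]

/-- ★ **13D′ in quotient currency for covariances**: `Cov^{w_J}_{D′}(F,G) = Tilt.tiltCov μ_{D′} (tiltU β H) 1 F G`. -/
theorem cov_fpChartWeight_eq_of_subset (hH : 1 ≤ H) (hs0 : 0 ≤ s) (hsr : s ≤ r) (hsπ : s < Real.pi) (hr : 0 < r)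
    (hdet : ∀ a ∈ smallField H s, (fpOperator H (edgeChart H a)).det ≠ 0) {D' : Set (LandauFree H → E3)} (hD'm : MeasurableSet D')
    (hD' : D' ⊆ smallField H s) (F G : (LandauFree H → E3) → ℝ) :
    (∫ a in D', F a * G a * fpChartWeight β H r a) / (∫ a in D', fpChartWeight β H r a) -
        (∫ a in D', F a * fpChartWeight β H r a) / (∫ a in D', fpChartWeight β H r a) *
          ((∫ a in D', G a * fpChartWeight β H r a) / (∫ a in D', fpChartWeight β H r a)) =
      Tilt.tiltCov (((volume : Measure (LandauFree H → E3)).restrict D').withDensity fun a => ENNReal.ofReal (gaussWeight β H a))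
        (tiltU β H) 1 F G := by
  rw [Tilt.tiltCov, ← setIntegral_fpChartWeight_div_eq_of_subset hH hs0 hsr hsπ hr hdet hD'm hD' (fun a => F a * G a),
    ← setIntegral_fpChartWeight_div_eq_of_subset hH hs0 hsr hsπ hr hdet hD'm hD' F,
    ← setIntegral_fpChartWeight_div_eq_of_subset hH hs0 hsr hsπ hr hdet hD'm hD' G]

/-! ## §3 C′: restricting the FP-chart covariance from `D` to a subset costs `6τB²` -/

/-- On the small field (with `hdet`) the FP-chart weight is strictly positive (✓5n-R factorisation: `K·gaussWeight·e^{tiltU}`, all factors positive). -/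
theorem fpChartWeight_pos_of_mem_smallField (hH : 1 ≤ H) (hs0 : 0 ≤ s) (hsr : s ≤ r) (hsπ : s < Real.pi) (hr : 0 < r)
    {a : LandauFree H → E3} (ha : a ∈ smallField H s) (hdet : (fpOperator H (edgeChart H a)).det ≠ 0) :
    0 < fpChartWeight β H r a := by
  rw [fpChartWeight_eq_on_smallField hH hs0 hsr hsπ hr ha hdet]
  have hK : 0 < |(fpOperator H 1).det| * sigmaSU2 0 ^ Fintype.card (LandauFree H) :=
    mul_pos (abs_pos.2 (det_fpOperator_one_ne_zero H)) (pow_pos (sigmaSU2_pos le_rfl Real.pi_pos) _)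
  exact mul_pos (mul_pos hK (gaussWeight_pos β H a)) (Real.exp_pos _)

/-- A bounded measurable function times the FP-chart weight is integrable on the small field (✓`BoxToChart.integrableOn_obs_mul_fpChartWeight`
with the trivial observable, then `Integrable.bdd_mul`). -/
theorem integrableOn_mul_fpChartWeight_smallField (hβ : 0 ≤ β) (hs0 : 0 ≤ s) (r : ℝ) {F : (LandauFree H → E3) → ℝ} {B : ℝ}
    (hFm : Measurable F) (hFb : ∀ a, |F a| ≤ B) :
    IntegrableOn (fun a => F a * fpChartWeight β H r a) (smallField H s) := by
  have h1B : ∀ U : Literature.MathematicalPhysics.QuantumLattice.LGConfig 4 SU2, |(fun _ => (1 : ℝ)) U| ≤ 1 := fun U => by simp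
  have h := BoxToChart.integrableOn_obs_mul_fpChartWeight (H := H) hβ r
    (measurable_const : Measurable fun _ : Literature.MathematicalPhysics.QuantumLattice.LGConfig 4 SU2 => (1 : ℝ)) h1B
    (SmallFieldFP.volume_smallField_lt_top (H := H) hs0)
  simp only [one_mul] at h
  exact h.bdd_mul hFm.aestronglyMeasurable (ae_of_all _ fun a => by rw [Real.norm_eq_abs]; exact hFb a)

/-- The FP-chart weight is integrable on the small field. -/
theorem integrableOn_fpChartWeight_smallField' (hβ : 0 ≤ β) (hs0 : 0 ≤ s) (r : ℝ) :
    IntegrableOn (fpChartWeight β H r) (smallField H s) := by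
  have h := integrableOn_mul_fpChartWeight_smallField (H := H) hβ hs0 r (F := fun _ => (1 : ℝ)) (B := 1) measurable_const
    (fun _ => by simp)
  simp only [one_mul] at h
  exact h

/-- ★ The FP-chart normaliser over the small field is positive: `0 < ∫_D w_J` (`0 < s`, `hdet`). -/
theorem setIntegral_fpChartWeight_smallField_pos (hH : 1 ≤ H) (hβ : 0 ≤ β) (hs : 0 < s) (hsr : s ≤ r) (hsπ : s < Real.pi) (hr : 0 < r)
    (hdet : ∀ a ∈ smallField H s, (fpOperator H (edgeChart H a)).det ≠ 0) :
    0 < ∫ a in smallField H s, fpChartWeight β H r a := by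
  rw [setIntegral_pos_iff_support_of_nonneg_ae (ae_of_all _ fun a => FPChart.fpChartWeight_nonneg β r a)
    (integrableOn_fpChartWeight_smallField' hβ hs.le r)]
  have hsub : smallField H s ⊆ Function.support (fpChartWeight β H r) ∩ smallField H s := fun a ha =>
    ⟨(fpChartWeight_pos_of_mem_smallField hH hs.le hsr hsπ hr ha (hdet a ha)).ne', ha⟩
  exact lt_of_lt_of_le (GaussRestrict.volume_smallField_pos H hs) (measure_mono hsub)

/-- ★★ **C′ (subset form)**: for a measurable `D′ ⊆ D = smallField H s` carrying all but a fraction `τ ≤ 1/2` of the FP-chart weight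
(`∫_{D∖D′} w_J ≤ τ·∫_D w_J`) and measurable `|F|, |G| ≤ B`, the FP-chart covariances over `D` and over `D′` differ by `≤ 6τB²`. -/
theorem abs_chartCov_sub_chartCov_subset_le (hH : 1 ≤ H) (hβ : 0 ≤ β) (hs : 0 < s) (hsr : s ≤ r) (hsπ : s < Real.pi) (hr : 0 < r)
    (hdet : ∀ a ∈ smallField H s, (fpOperator H (edgeChart H a)).det ≠ 0) {D' : Set (LandauFree H → E3)} (hD'm : MeasurableSet D')
    (hD' : D' ⊆ smallField H s) {τ : ℝ}
    (hτ : ∫ a in smallField H s \ D', fpChartWeight β H r a ≤ τ * ∫ a in smallField H s, fpChartWeight β H r a) (hτ2 : τ ≤ 1 / 2)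
    {F G : (LandauFree H → E3) → ℝ} {B : ℝ} (hFm : Measurable F) (hGm : Measurable G) (hFb : ∀ a, |F a| ≤ B) (hGb : ∀ a, |G a| ≤ B) :
    |((∫ a in smallField H s, F a * G a * fpChartWeight β H r a) / (∫ a in smallField H s, fpChartWeight β H r a) -
          (∫ a in smallField H s, F a * fpChartWeight β H r a) / (∫ a in smallField H s, fpChartWeight β H r a) *
            ((∫ a in smallField H s, G a * fpChartWeight β H r a) / (∫ a in smallField H s, fpChartWeight β H r a))) -
        ((∫ a in D', F a * G a * fpChartWeight β H r a) / (∫ a in D', fpChartWeight β H r a) -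
          (∫ a in D', F a * fpChartWeight β H r a) / (∫ a in D', fpChartWeight β H r a) *
            ((∫ a in D', G a * fpChartWeight β H r a) / (∫ a in D', fpChartWeight β H r a)))| ≤
      6 * τ * B ^ 2 :=
  Restrict.abs_covDensity_sub_covDensity_subset_le (μ := volume) (FPChart.measurable_fpChartWeight β H r) (FPChart.fpChartWeight_nonneg β r)
    hD'm hD' (integrableOn_fpChartWeight_smallField' hβ hs.le r) (setIntegral_fpChartWeight_smallField_pos hH hβ hs hsr hsπ hr hdet) hτ hτ2
    hFm hGm hFb hGb

/-- From the cut-event shape `∫_{D∩E} w ≤ τ·∫_{D∖E} w` (✓`exists_beta0_cubicCut`) to the subset shape `∫_{D∖(D∖E)} w ≤ τ·∫_D w` (`w ≥ 0`, `0 ≤ τ`). -/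
theorem cut_mass_le_of_inter_le {E : Set (LandauFree H → E3)} (hβ : 0 ≤ β) (hs0 : 0 ≤ s) {τ : ℝ} (hτ0 : 0 ≤ τ)
    (hcut : ∫ a in smallField H s ∩ E, fpChartWeight β H r a ≤ τ * ∫ a in smallField H s \ E, fpChartWeight β H r a) :
    ∫ a in smallField H s \ (smallField H s \ E), fpChartWeight β H r a ≤ τ * ∫ a in smallField H s, fpChartWeight β H r a := by
  have hDm : MeasurableSet (smallField H s) := ChartGauss.measurableSet_smallField s
  have hset : smallField H s \ (smallField H s \ E) = smallField H s ∩ E := by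
    ext a; constructor
    · rintro ⟨ha, hna⟩
      exact ⟨ha, by_contra fun hE => hna ⟨ha, hE⟩⟩
    · rintro ⟨ha, hE⟩
      exact ⟨ha, fun h => h.2 hE⟩
  rw [hset]
  refine hcut.trans (mul_le_mul_of_nonneg_left ?_ hτ0)
  exact setIntegral_mono_set (integrableOn_fpChartWeight_smallField' hβ hs0 r)
    (ae_of_all _ fun a => FPChart.fpChartWeight_nonneg β r a) (ae_of_all _ Set.sdiff_subset)

/-- ★★ **C′ (cut-event form)**: with `D′ = D ∖ E` for a measurable event `E` and the hypothesis in EXACTLY the shape of ✓`SmallFieldFP.exists_beta0_cubicCut`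
(`∫_{D∩E} w_J ≤ τ·∫_{D∖E} w_J`, `0 ≤ τ ≤ 1/2`): `|Cov^{w_J}_D(F,G) − Cov^{w_J}_{D∖E}(F,G)| ≤ 6τB²`. -/
theorem abs_chartCov_sub_chartCov_diff_le (hH : 1 ≤ H) (hβ : 0 ≤ β) (hs : 0 < s) (hsr : s ≤ r) (hsπ : s < Real.pi) (hr : 0 < r)
    (hdet : ∀ a ∈ smallField H s, (fpOperator H (edgeChart H a)).det ≠ 0) {E : Set (LandauFree H → E3)} (hEm : MeasurableSet E) {τ : ℝ}
    (hτ0 : 0 ≤ τ) (hcut : ∫ a in smallField H s ∩ E, fpChartWeight β H r a ≤ τ * ∫ a in smallField H s \ E, fpChartWeight β H r a)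
    (hτ2 : τ ≤ 1 / 2) {F G : (LandauFree H → E3) → ℝ} {B : ℝ} (hFm : Measurable F) (hGm : Measurable G) (hFb : ∀ a, |F a| ≤ B)
    (hGb : ∀ a, |G a| ≤ B) :
    |((∫ a in smallField H s, F a * G a * fpChartWeight β H r a) / (∫ a in smallField H s, fpChartWeight β H r a) -
          (∫ a in smallField H s, F a * fpChartWeight β H r a) / (∫ a in smallField H s, fpChartWeight β H r a) *
            ((∫ a in smallField H s, G a * fpChartWeight β H r a) / (∫ a in smallField H s, fpChartWeight β H r a))) -
        ((∫ a in smallField H s \ E, F a * G a * fpChartWeight β H r a) / (∫ a in smallField H s \ E, fpChartWeight β H r a) -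
          (∫ a in smallField H s \ E, F a * fpChartWeight β H r a) / (∫ a in smallField H s \ E, fpChartWeight β H r a) *
            ((∫ a in smallField H s \ E, G a * fpChartWeight β H r a) / (∫ a in smallField H s \ E, fpChartWeight β H r a)))| ≤
      6 * τ * B ^ 2 :=
  abs_chartCov_sub_chartCov_subset_le hH hβ hs hsr hsπ hr hdet ((ChartGauss.measurableSet_smallField s).diff hEm) Set.sdiff_subset
    (cut_mass_le_of_inter_le hβ hs.le hτ0 hcut) hτ2 hFm hGm hFb hGb

/-- ★★ **The `t = 1` glue of Steps D–E on the cut set**: the FP-chart covariance over `D` (the output currency of Steps A–C,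
✓`BoxToChart.boxPlaqCov_sub_chartCov_relative_sup'`) equals the `t = 1` tilted Gaussian covariance over `μ_{D∖E}` up to `6τB²`
(C′ + 13D′; `τ` from ✓`exists_beta0_cubicCut`). -/
theorem abs_chartCov_sub_tiltCov_muCut_one_le (hH : 1 ≤ H) (hβ : 0 ≤ β) (hs : 0 < s) (hsr : s ≤ r) (hsπ : s < Real.pi) (hr : 0 < r)
    (hdet : ∀ a ∈ smallField H s, (fpOperator H (edgeChart H a)).det ≠ 0) {E : Set (LandauFree H → E3)} (hEm : MeasurableSet E) {τ : ℝ}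
    (hτ0 : 0 ≤ τ) (hcut : ∫ a in smallField H s ∩ E, fpChartWeight β H r a ≤ τ * ∫ a in smallField H s \ E, fpChartWeight β H r a)
    (hτ2 : τ ≤ 1 / 2) {F G : (LandauFree H → E3) → ℝ} {B : ℝ} (hFm : Measurable F) (hGm : Measurable G) (hFb : ∀ a, |F a| ≤ B)
    (hGb : ∀ a, |G a| ≤ B) :
    |((∫ a in smallField H s, F a * G a * fpChartWeight β H r a) / (∫ a in smallField H s, fpChartWeight β H r a) -
          (∫ a in smallField H s, F a * fpChartWeight β H r a) / (∫ a in smallField H s, fpChartWeight β H r a) *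
            ((∫ a in smallField H s, G a * fpChartWeight β H r a) / (∫ a in smallField H s, fpChartWeight β H r a))) -
        Tilt.tiltCov (((volume : Measure (LandauFree H → E3)).restrict (smallField H s \ E)).withDensity fun a =>
            ENNReal.ofReal (gaussWeight β H a)) (tiltU β H) 1 F G| ≤
      6 * τ * B ^ 2 := by
  rw [← cov_fpChartWeight_eq_of_subset hH hs.le hsr hsπ hr hdet ((ChartGauss.measurableSet_smallField s).diff hEm) Set.sdiff_subset F G]
  exact abs_chartCov_sub_chartCov_diff_le hH hβ hs hsr hsπ hr hdet hEm hτ0 hcut hτ2 hFm hGm hFb hGb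

/-- The same for two chart plaquette costs (`B = 4`, ✓`TiltSup.abs_chartPlaqCost_le_four`): `≤ 96·τ`. -/
theorem abs_chartCov_sub_tiltCov_muCut_one_le_chartPlaqCost (hH : 1 ≤ H) (hβ : 0 ≤ β) (hs : 0 < s) (hsr : s ≤ r) (hsπ : s < Real.pi)
    (hr : 0 < r) (hdet : ∀ a ∈ smallField H s, (fpOperator H (edgeChart H a)).det ≠ 0) {E : Set (LandauFree H → E3)}
    (hEm : MeasurableSet E) {τ : ℝ} (hτ0 : 0 ≤ τ)
    (hcut : ∫ a in smallField H s ∩ E, fpChartWeight β H r a ≤ τ * ∫ a in smallField H s \ E, fpChartWeight β H r a) (hτ2 : τ ≤ 1 / 2)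
    (x y : Site 4) :
    |((∫ a in smallField H s, chartPlaqCost H x 1 2 a * chartPlaqCost H y 1 2 a * fpChartWeight β H r a) /
            (∫ a in smallField H s, fpChartWeight β H r a) -
          (∫ a in smallField H s, chartPlaqCost H x 1 2 a * fpChartWeight β H r a) / (∫ a in smallField H s, fpChartWeight β H r a) *
            ((∫ a in smallField H s, chartPlaqCost H y 1 2 a * fpChartWeight β H r a) / (∫ a in smallField H s, fpChartWeight β H r a))) -
        Tilt.tiltCov (((volume : Measure (LandauFree H → E3)).restrict (smallField H s \ E)).withDensity fun a =>
            ENNReal.ofReal (gaussWeight β H a)) (tiltU β H) 1 (chartPlaqCost H x 1 2) (chartPlaqCost H y 1 2)| ≤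
      96 * τ := by
  have h := abs_chartCov_sub_tiltCov_muCut_one_le hH hβ hs hsr hsπ hr hdet hEm hτ0 hcut hτ2
    (EdgeChartGaussian.measurable_chartPlaqCost H x 1 2) (EdgeChartGaussian.measurable_chartPlaqCost H y 1 2)
    (TiltSup.abs_chartPlaqCost_le_four x 1 2) (TiltSup.abs_chartPlaqCost_le_four y 1 2)
  linarith

end GaussNormalForm

end Summit.QuantumFields.YangMills.Theorems.AllWindowsColdBoxBoxHighLine

end
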